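import Summits.ValiantsHypothesis.ValiantsHypothesis.Theorems.EquivariantDialPairAlgebra
import Summits.ValiantsHypothesis.ValiantsHypothesis.Theorems.EquivariantDialCocycleAveraging
import Summits.ValiantsHypothesis.ValiantsHypothesis.Theorems.EquivariantDialBlockGaugeAssembly
import Mathlib.FieldTheory.IsAlgClosed.Basic
import Mathlib.Algebra.Polynomial.Roots
import HarnessLib

/-!
# Finite lift groups of LOCAL equivariant representations; cell `A` from `LocalShrinking`

(decomp-valiant workshop, lens 1 «representation-theoretic obstruction splitting», generation 27, file 3 of 3) —
support file of the census cell `A = EquivariantDialNode.EqHardBiPerm` (item `stmt-ValiantsHypothesis-23702`).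
HONEST SCOPE — five standing sentences: NOT a route, closes NO item.
VP ≠ VNP is NOT proved here and nothing below is progress on it.
The cell A (EqHardBiPerm) itself is NOT proved (it is derived below ONLY from an unproved hypothesis); 0 S-currency.
The series' residual hypothesis
LocalShrinking [status: PAPER; NOT proved in the tree; typed ONLY as a hypothesis: no _holds, no instance, no default argument]
is DECLARED in this file (`def LocalShrinking : Prop`) and used only as the antecedent of the last theorem.

WHAT IS PROVED HERE (complete proofs; elementary linear algebra over a field `k`).
§1 A unit of a pair-lift space is an exact lift (`linSubstEntries_eq_of_mem_pairLift`, the twin's F1 item, moved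
here).  For an equivariant affine representation `A` (`IsEquivariantDetRepr Γ f A`, size `s ≥ 1`) which is LOCAL
(`IsLocalRepr A`, file 1) the pair-lift spaces `a ↦ pairLift A ↑a⁻¹` and the normalised pair trace form a graded
lift system (`isGradedLift_pairLift` — the non-vacuity witness of file 2's `IsGradedLift`); hence, for `Γ` FINITE and
`char k = 0`, file 2's cocycle averaging yields PROJECTIVE exact lifts `y_a y_b = μ(a,b) · y_{ab}`
(`exists_projective_pairLifts`); over an algebraically closed field they can be rescaled to `det = 1` on the first
component, after which the scalars are `s`-th roots of unity (`exists_detOne_pairLifts`); the `μ_s`-multiples of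
these lifts then form a FINITE subgroup of `GL_s × GL_s` containing an exact lift of every `γ ∈ Γ`:
★ `isFinEquivariantDetRepr_of_isLocalRepr` (g26's `IsFinEquivariantDetRepr`).  Size `0` is trivial.
§2 The window substitution group `biPermSubst m` is finite; `LocalShrinking` (below) says every window-equivariant
affine representation of `per_m` may be replaced by a window-equivariant LOCAL one of no larger size; with g26's
`eqHardBiPermFin` (no polynomial-size window-equivariant representation with lifts in a finite group) this gives
★ `eqHardBiPerm_of_localShrinking : LocalShrinking → EqHardBiPerm`.
NON-VACUITY (K6): local window-equivariant representations exist: for m ≤ 2 the tree pads are 1×1 / explicit, and on paper the Grenet/LR constructions restricted to 𝔖_m×𝔖_m have scalar intertwiner algebras; LocalShrinking lower-bounds a non-empty class and is implied on paper by Krull–Schmidt for equivariant pencils — NOT proved here.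
WHAT THIS REPLACES.  g26 derived cell `A` from `FiniteLiftSupplement` (a finite supplement of the identity component of
the algebraic lift group: Borel–Serre / Brion, Lean-far).  The present series proves the finite-supplement statement
OUTRIGHT in the local case, by elementary algebra (nilpotent trace kernel + cocycle averaging + `det`-normalisation),
so the residual of cell `A` becomes the purely representation-theoretic `LocalShrinking` (Krull–Schmidt / Fitting).
GRADE (planner's reading; the critic decides): KNOWN-TYPE mathematics (a special case of the finiteness of component
groups of stabilisers, cf. M. Brion, arXiv:1502.05049, Thm. 1.1 (special case, elementary proof; no bib key — cited by
arXiv id); cocycle averaging as in [cite: Babakhanian1972, §15.8]; the lift group of an equivariant representation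
[cite: LandsbergRessayre2017, §3.3]), KERNEL-NEW; closes NO item; residual swap `FiniteLiftSupplement ↦ LocalShrinking`.
-/

set_option linter.dupNamespace false

namespace Summit.ValiantsHypothesis.ValiantsHypothesis.Theorems.EquivariantDialFiniteSupplement

open MvPolynomial Matrix Literature.Computability.AlgebraicComplexity
open Summit.ValiantsHypothesis.ValiantsHypothesis.Theorems.EquivariantDialNode
open Summit.ValiantsHypothesis.ValiantsHypothesis.Theorems.EquivariantDialLayers
open Summit.ValiantsHypothesis.ValiantsHypothesis.Theorems.EquivariantDialFiniteLifts
open Summit.ValiantsHypothesis.ValiantsHypothesis.Theorems.EquivariantDialPairAlgebra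
open Summit.ValiantsHypothesis.ValiantsHypothesis.Theorems.EquivariantDialCocycleAveraging

/-! ## §1 Local equivariant representations have finite lift groups -/
section General
variable {k : Type*} [Field k] {σ : Type*} [Fintype σ] [DecidableEq σ] {s : ℕ}

/-- A unit `x = (p, q)` of the pair-lift space `L_γ` is an EXACT lift: `γ • A = C(p) · A · C(q)⁻¹` (pinned item of
the series' statement twin, F1 section l.101–107, moved to this file where it is consumed). -/
theorem linSubstEntries_eq_of_mem_pairLift {A : Matrix (Fin s) (Fin s) (MvPolynomial σ k)} {γ : GL σ k}
    (x : (Matrix (Fin s) (Fin s) k × Matrix (Fin s) (Fin s) k)ˣ)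
    (hx : (x : Matrix (Fin s) (Fin s) k × Matrix (Fin s) (Fin s) k) ∈ pairLift A γ) :
    Matrix.linSubstEntries γ A = (x : Matrix (Fin s) (Fin s) k × Matrix (Fin s) (Fin s) k).1.map C * A *
      ((x⁻¹ : (Matrix (Fin s) (Fin s) k × Matrix (Fin s) (Fin s) k)ˣ) :
        Matrix (Fin s) (Fin s) k × Matrix (Fin s) (Fin s) k).2.map C := by
  have hXY : (x : Matrix (Fin s) (Fin s) k × Matrix (Fin s) (Fin s) k).2.map C *
      ((x⁻¹ : (Matrix (Fin s) (Fin s) k × Matrix (Fin s) (Fin s) k)ˣ) :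
        Matrix (Fin s) (Fin s) k × Matrix (Fin s) (Fin s) k).2.map C = (1 : Matrix (Fin s) (Fin s) (MvPolynomial σ k)) := by
    rw [← Matrix.map_mul, ← Prod.snd_mul, Units.mul_inv, Prod.snd_one, Matrix.map_one C C_0 C_1]
  rw [← Matrix.mul_one (Matrix.linSubstEntries γ A), ← hXY, ← Matrix.mul_assoc, ← mem_pairLift.mp hx]

/-- The pair-lift spaces `a ↦ pairLift A ↑a⁻¹` of a LOCAL representation and the normalised pair trace form a
graded lift system in the sense of file 2 (the non-vacuity witness of `IsGradedLift`). -/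
theorem isGradedLift_pairLift [CharZero k] {A : Matrix (Fin s) (Fin s) (MvPolynomial σ k)} (hs : 0 < s)
    (hloc : IsLocalRepr A) (Γ : Subgroup (GL σ k)) :
    IsGradedLift (fun a : Γ => pairLift A ((a⁻¹ : Γ) : GL σ k)) (pairTrace s k) := by
  have h1 : ∀ {y : Matrix (Fin s) (Fin s) k × Matrix (Fin s) (Fin s) k},
      y ∈ pairLift A (((1 : Γ)⁻¹ : Γ) : GL σ k) ↔ y ∈ pairAlg A := fun {y} => by
    rw [inv_one, OneMemClass.coe_one, mem_pairLift_one]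
  exact
    { one_mem := h1.mpr (one_mem _)
      mul_mem := fun {a b y z} hy hz => by
        show y * z ∈ pairLift A (((a * b)⁻¹ : Γ) : GL σ k)
        rw [_root_.mul_inv_rev, Subgroup.coe_mul]
        exact mul_mem_pairLift hy hz
      map_one := pairTrace_one hs
      map_mul := fun hy hz => hloc.pairTrace_mul hs (h1.mp hy) (h1.mp hz) }

/-- PROJECTIVE exact lifts: for a LOCAL equivariant representation (`s ≥ 1`, `Γ` finite, `char k = 0`) the exact
lifts can be chosen in the pair-lift spaces with `y_a y_b = μ(a,b) · y_{ab}`, `μ(a,b) ≠ 0` (file 2's cocycle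
averaging applied to file 1's nilpotent trace kernel). -/
theorem exists_projective_pairLifts [CharZero k] {Γ : Subgroup (GL σ k)} [Finite Γ] {f : MvPolynomial σ k}
    {A : Matrix (Fin s) (Fin s) (MvPolynomial σ k)} (hs : 0 < s) (hA : IsEquivariantDetRepr Γ f A)
    (hloc : IsLocalRepr A) :
    ∃ y : Γ → (Matrix (Fin s) (Fin s) k × Matrix (Fin s) (Fin s) k)ˣ,
      (∀ a, (y a : Matrix (Fin s) (Fin s) k × Matrix (Fin s) (Fin s) k) ∈ pairLift A ((a⁻¹ : Γ) : GL σ k)) ∧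
      ∀ a b : Γ, ∃ μ : k, μ ≠ 0 ∧ (y a : Matrix (Fin s) (Fin s) k × Matrix (Fin s) (Fin s) k) * (y b : _) =
        μ • (y (a * b) : Matrix (Fin s) (Fin s) k × Matrix (Fin s) (Fin s) k) := by
  have hL := isGradedLift_pairLift hs hloc Γ
  obtain ⟨N, hN0, hN⟩ := hloc.exists_pow_eq_bot hs
  have hN' : ((fun a : Γ => pairLift A ((a⁻¹ : Γ) : GL σ k)) 1 ⊓ LinearMap.ker (pairTrace s k)) ^ N = ⊥ := by
    show (pairLift A (((1 : Γ)⁻¹ : Γ) : GL σ k) ⊓ LinearMap.ker (pairTrace s k)) ^ N = ⊥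
    rw [inv_one, OneMemClass.coe_one, ← toSubmodule_pairAlg]; exact hN
  choose x hx hx' using fun a : Γ => exists_unit_mem_pairLift hA (a⁻¹).2
  obtain ⟨y, hy, -, hmul⟩ := hL.exists_projective_lifts hN0 hN' x hx fun a => by
    show _ ∈ pairLift A (((a⁻¹)⁻¹ : Γ) : GL σ k)
    rw [Subgroup.coe_inv]; exact hx' a
  exact ⟨y, hy, hmul⟩

/-- `det`-NORMALISED projective lifts: over an algebraically closed field of characteristic `0` the projective exact
lifts can be rescaled to `det (z_a).1 = 1`; the scalars `ν(a,b)` are then `s`-th roots of unity. -/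
theorem exists_detOne_pairLifts [IsAlgClosed k] [CharZero k] {Γ : Subgroup (GL σ k)} [Finite Γ]
    {f : MvPolynomial σ k} {A : Matrix (Fin s) (Fin s) (MvPolynomial σ k)} (hs : 0 < s)
    (hA : IsEquivariantDetRepr Γ f A) (hloc : IsLocalRepr A) :
    ∃ z : Γ → (Matrix (Fin s) (Fin s) k × Matrix (Fin s) (Fin s) k)ˣ,
      (∀ a, (z a : Matrix (Fin s) (Fin s) k × Matrix (Fin s) (Fin s) k) ∈ pairLift A ((a⁻¹ : Γ) : GL σ k)) ∧
      (∀ a, ((z a : Matrix (Fin s) (Fin s) k × Matrix (Fin s) (Fin s) k).1).det = 1) ∧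
      ∀ a b : Γ, ∃ ν : k, ν ^ s = 1 ∧ (z a : Matrix (Fin s) (Fin s) k × Matrix (Fin s) (Fin s) k) * (z b : _) =
        ν • (z (a * b) : Matrix (Fin s) (Fin s) k × Matrix (Fin s) (Fin s) k) := by
  obtain ⟨y, hy, hmul⟩ := exists_projective_pairLifts hs hA hloc
  have hdet : ∀ a, ((y a : Matrix (Fin s) (Fin s) k × Matrix (Fin s) (Fin s) k).1).det ≠ 0 := fun a =>
    ((Matrix.isUnit_iff_isUnit_det _).mp (Prod.isUnit_iff.mp (y a).isUnit).1).ne_zero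
  choose ω hω using fun a =>
    IsAlgClosed.exists_pow_nat_eq ((y a : Matrix (Fin s) (Fin s) k × Matrix (Fin s) (Fin s) k).1).det hs
  have hω0 : ∀ a, ω a ≠ 0 := fun a h => hdet a (by rw [← hω a, h, zero_pow hs.ne'])
  have hsc : ∀ (c d : k) (p q : Matrix (Fin s) (Fin s) k × Matrix (Fin s) (Fin s) k),
      c * d = 1 → p * q = 1 → (c • p) * (d • q) = 1 := fun c d p q h h' => by
    rw [smul_mul_assoc, mul_smul_comm, smul_smul, h, one_smul, h']
  obtain ⟨z, hz⟩ : ∃ z : Γ → (Matrix (Fin s) (Fin s) k × Matrix (Fin s) (Fin s) k)ˣ, ∀ a,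
      (z a : Matrix (Fin s) (Fin s) k × Matrix (Fin s) (Fin s) k) =
        (ω a)⁻¹ • (y a : Matrix (Fin s) (Fin s) k × Matrix (Fin s) (Fin s) k) :=
    ⟨fun a => ⟨(ω a)⁻¹ • (y a : Matrix (Fin s) (Fin s) k × Matrix (Fin s) (Fin s) k),
      ω a • (((y a)⁻¹ : (Matrix (Fin s) (Fin s) k × Matrix (Fin s) (Fin s) k)ˣ) :
        Matrix (Fin s) (Fin s) k × Matrix (Fin s) (Fin s) k),
      hsc _ _ _ _ (inv_mul_cancel₀ (hω0 a)) (y a).mul_inv,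
      hsc _ _ _ _ (mul_inv_cancel₀ (hω0 a)) (y a).inv_mul⟩, fun a => rfl⟩
  have hz1 : ∀ a, ((z a : Matrix (Fin s) (Fin s) k × Matrix (Fin s) (Fin s) k).1).det = 1 := fun a => by
    rw [hz, Prod.smul_fst, Matrix.det_smul, Fintype.card_fin, ← hω a, ← mul_pow, inv_mul_cancel₀ (hω0 a),
      one_pow]
  refine ⟨z, fun a => by rw [hz]; exact Submodule.smul_mem _ _ (hy a), hz1, fun a b => ?_⟩
  obtain ⟨μ, -, hμ⟩ := hmul a b
  have heq : (z a : Matrix (Fin s) (Fin s) k × Matrix (Fin s) (Fin s) k) * (z b : _) =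
      ((ω a)⁻¹ * (ω b)⁻¹ * μ * ω (a * b)) • (z (a * b) : Matrix (Fin s) (Fin s) k × Matrix (Fin s) (Fin s) k) := by
    rw [hz, hz, hz, smul_mul_assoc, mul_smul_comm, smul_smul, hμ, smul_smul, smul_smul,
      mul_assoc ((ω a)⁻¹ * (ω b)⁻¹ * μ), mul_inv_cancel₀ (hω0 (a * b)), mul_one]
  refine ⟨_, ?_, heq⟩
  have e := congrArg (fun w : Matrix (Fin s) (Fin s) k × Matrix (Fin s) (Fin s) k => (w.1).det) heq
  simp only [Prod.fst_mul, Matrix.det_mul, Prod.smul_fst, Matrix.det_smul, Fintype.card_fin, hz1, mul_one] at e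
  exact e.symm

/-- The `s`-th roots of unity of a field form a finite type (`s ≥ 1`). -/
theorem finite_powEqOne (k : Type*) [Field k] {s : ℕ} (hs : 0 < s) : Finite {ω : k // ω ^ s = 1} := by
  classical
  have h : {ω : k | ω ^ s = 1} ⊆ ↑(Polynomial.nthRoots s (1 : k)).toFinset := fun ω hω => by
    rw [Finset.mem_coe, Multiset.mem_toFinset, Polynomial.mem_nthRoots hs]; exact hω
  exact ((Polynomial.nthRoots s (1 : k)).toFinset.finite_toSet.subset h).to_subtype

/-- ★ A LOCAL equivariant representation (`s ≥ 1`, `Γ` finite, `k` algebraically closed of characteristic `0`)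
has its exact lifts inside ONE FINITE subgroup of `GL_s × GL_s`. -/
theorem isFinEquivariantDetRepr_of_isLocalRepr [IsAlgClosed k] [CharZero k] {Γ : Subgroup (GL σ k)} [Finite Γ]
    {f : MvPolynomial σ k} {A : Matrix (Fin s) (Fin s) (MvPolynomial σ k)} (hs : 0 < s)
    (hA : IsEquivariantDetRepr Γ f A) (hloc : IsLocalRepr A) : IsFinEquivariantDetRepr Γ f A := by
  obtain ⟨z, hz, hz1, hzν⟩ := exists_detOne_pairLifts hs hA hloc
  have hne : ∀ {ω : k}, ω ^ s = 1 → ω ≠ 0 := fun hω h => by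
    rw [h, zero_pow hs.ne'] at hω; exact zero_ne_one hω
  have hsc : ∀ (c d : k) (p q : Matrix (Fin s) (Fin s) k × Matrix (Fin s) (Fin s) k),
      c * d = 1 → p * q = 1 → (c • p) * (d • q) = 1 := fun c d p q h h' => by
    rw [smul_mul_assoc, mul_smul_comm, smul_smul, h, one_smul, h']
  -- the units `ω • z_a` (`ω ^ s = 1`, `a ∈ Γ`)
  obtain ⟨u, hu⟩ : ∃ u : {ω : k // ω ^ s = 1} × Γ → (Matrix (Fin s) (Fin s) k × Matrix (Fin s) (Fin s) k)ˣ,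
      ∀ p, (u p : Matrix (Fin s) (Fin s) k × Matrix (Fin s) (Fin s) k) =
        (p.1 : k) • (z p.2 : Matrix (Fin s) (Fin s) k × Matrix (Fin s) (Fin s) k) :=
    ⟨fun p => ⟨(p.1 : k) • (z p.2 : Matrix (Fin s) (Fin s) k × Matrix (Fin s) (Fin s) k),
      (p.1 : k)⁻¹ • (((z p.2)⁻¹ : (Matrix (Fin s) (Fin s) k × Matrix (Fin s) (Fin s) k)ˣ) :
        Matrix (Fin s) (Fin s) k × Matrix (Fin s) (Fin s) k),
      hsc _ _ _ _ (mul_inv_cancel₀ (hne p.1.2)) (z p.2).mul_inv,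
      hsc _ _ _ _ (inv_mul_cancel₀ (hne p.1.2)) (z p.2).inv_mul⟩, fun p => rfl⟩
  -- `z 1` is a scalar (a root of unity)
  obtain ⟨ν₁, hν₁, e₁⟩ := hzν 1 1
  rw [mul_one] at e₁
  have h11 : (z 1 : Matrix (Fin s) (Fin s) k × Matrix (Fin s) (Fin s) k) =
      ν₁ • (1 : Matrix (Fin s) (Fin s) k × Matrix (Fin s) (Fin s) k) :=
    calc (z 1 : Matrix (Fin s) (Fin s) k × Matrix (Fin s) (Fin s) k)
        = (z 1 : Matrix (Fin s) (Fin s) k × Matrix (Fin s) (Fin s) k) * (z 1 : _) *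
            (((z 1)⁻¹ : (Matrix (Fin s) (Fin s) k × Matrix (Fin s) (Fin s) k)ˣ) :
              Matrix (Fin s) (Fin s) k × Matrix (Fin s) (Fin s) k) := (Units.mul_inv_cancel_right _ _).symm
      _ = ν₁ • (1 : Matrix (Fin s) (Fin s) k × Matrix (Fin s) (Fin s) k) := by
          rw [e₁, smul_mul_assoc, Units.mul_inv]
  -- the finite subgroup: the image of `μ_s × Γ` in `GL_s × GL_s`
  obtain ⟨g, hg⟩ : ∃ g : {ω : k // ω ^ s = 1} × Γ → GL (Fin s) k × GL (Fin s) k,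
      ∀ p, g p = MulEquiv.prodUnits (u p) := ⟨_, fun _ => rfl⟩
  haveI := finite_powEqOne k hs
  refine ⟨hA.1, { carrier := Set.range g, mul_mem' := ?_, one_mem' := ?_, inv_mem' := ?_ },
    (Set.finite_range g).to_subtype, fun γ hγ => ?_⟩
  · rintro _ _ ⟨p, rfl⟩ ⟨q, rfl⟩
    obtain ⟨ν, hν, e⟩ := hzν p.2 q.2
    have hr : ((p.1 : k) * (q.1 : k) * ν) ^ s = 1 := by
      rw [mul_pow, mul_pow, p.1.2, q.1.2, hν, one_mul, one_mul]
    refine ⟨(⟨_, hr⟩, p.2 * q.2), ?_⟩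
    have hur : (u (⟨_, hr⟩, p.2 * q.2) : Matrix (Fin s) (Fin s) k × Matrix (Fin s) (Fin s) k) =
        ((p.1 : k) * (q.1 : k) * ν) • (z (p.2 * q.2) : Matrix (Fin s) (Fin s) k × Matrix (Fin s) (Fin s) k) :=
      hu _
    rw [hg, hg, hg, ← map_mul, show u (⟨_, hr⟩, p.2 * q.2) = u p * u q from Units.ext ?_]
    rw [hur, Units.val_mul, hu, hu, smul_mul_assoc, mul_smul_comm, smul_smul, e, smul_smul]
  · have hr : (ν₁⁻¹) ^ s = 1 := by rw [inv_pow, hν₁, inv_one]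
    refine ⟨(⟨_, hr⟩, 1), ?_⟩
    have hur : (u (⟨_, hr⟩, 1) : Matrix (Fin s) (Fin s) k × Matrix (Fin s) (Fin s) k) =
        ν₁⁻¹ • (z 1 : Matrix (Fin s) (Fin s) k × Matrix (Fin s) (Fin s) k) := hu _
    have h1 : u (⟨_, hr⟩, 1) = 1 :=
      Units.ext (by rw [hur, Units.val_one, h11, smul_smul, inv_mul_cancel₀ (hne hν₁), one_smul])
    rw [hg, h1, map_one]
  · rintro _ ⟨p, rfl⟩
    obtain ⟨ν, hν, e⟩ := hzν p.2 p.2⁻¹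
    rw [mul_inv_cancel, h11, smul_smul] at e
    have hr : ((p.1 : k)⁻¹ * (ν * ν₁)⁻¹) ^ s = 1 := by
      rw [mul_pow, inv_pow, inv_pow, mul_pow, p.1.2, hν, hν₁, one_mul, inv_one, one_mul]
    refine ⟨(⟨_, hr⟩, p.2⁻¹), ?_⟩
    have hur : (u (⟨_, hr⟩, p.2⁻¹) : Matrix (Fin s) (Fin s) k × Matrix (Fin s) (Fin s) k) =
        ((p.1 : k)⁻¹ * (ν * ν₁)⁻¹) • (z p.2⁻¹ : Matrix (Fin s) (Fin s) k × Matrix (Fin s) (Fin s) k) := hu _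
    rw [hg, hg, ← map_inv, ← inv_eq_of_mul_eq_one_right (show u p * u (⟨_, hr⟩, p.2⁻¹) = 1 from Units.ext ?_)]
    rw [Units.val_mul, Units.val_one, hu, hur, smul_mul_assoc, mul_smul_comm, smul_smul, e, smul_smul,
      mul_inv_cancel_left₀ (hne p.1.2), inv_mul_cancel₀ (mul_ne_zero (hne hν) (hne hν₁)), one_smul]
  · -- an exact lift of `γ` inside the subgroup: `z_b` with `b = γ⁻¹` (so that `z_b ∈ pairLift A γ`)
    obtain ⟨b, hb⟩ : ∃ b : Γ, ((b⁻¹ : Γ) : GL σ k) = γ := ⟨⟨γ, hγ⟩⁻¹, congrArg Subtype.val (inv_inv _)⟩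
    have hmem := hz b
    rw [hb] at hmem
    have hur : u (⟨1, one_pow s⟩, b) = z b := Units.ext (by rw [hu]; exact one_smul _ _)
    refine ⟨g (⟨1, one_pow s⟩, b), ⟨_, rfl⟩, ?_⟩
    rw [hg, hur]
    exact linSubstEntries_eq_of_mem_pairLift (z b) hmem

/-- Size `0`: the trivial subgroup carries all lifts. -/
theorem isFinEquivariantDetRepr_of_size_zero {Γ : Subgroup (GL σ k)} {f : MvPolynomial σ k}
    {A : Matrix (Fin 0) (Fin 0) (MvPolynomial σ k)} (hA : IsEquivariantDetRepr Γ f A) :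
    IsFinEquivariantDetRepr Γ f A :=
  ⟨hA.1, ⊥, inferInstance, fun _ _ => ⟨1, Subgroup.one_mem _, Subsingleton.elim _ _⟩⟩

end General

/-! ## §2 The window: cell `A` from `LocalShrinking` -/
section Window

/-- The window substitution group (simultaneous row and column permutations of the `m × m` variables) is finite. -/
theorem finite_biPermSubst (m : ℕ) : Finite (biPermSubst m) := by
  let h : Equiv.Perm (Fin m) × Equiv.Perm (Fin m) → Matrix (Fin m × Fin m) (Fin m × Fin m) ℂ :=
    fun p => Equiv.Perm.permMatrix ℂ (Equiv.prodCongr p.1 p.2)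
  have hmem : ∀ γ : biPermSubst m,
      ((γ : GL (Fin m × Fin m) ℂ) : Matrix (Fin m × Fin m) (Fin m × Fin m) ℂ) ∈ Set.range h := fun γ => by
    obtain ⟨σ, τ, e⟩ := exists_prodCongr_of_mem_biPermSubst γ.2
    exact ⟨(σ, τ), e.symm⟩
  exact Finite.of_injective (fun γ : biPermSubst m => (⟨_, hmem γ⟩ : Set.range h)) fun γ δ e =>
    Subtype.ext (Units.ext (congrArg Subtype.val e))

/-- **`LocalShrinking`** — [status: PAPER (minimal-rank `per`-carrying idempotent of the pair algebra; g28 target); NOT proved in this file].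
LocalShrinking [status: PAPER; NOT proved in the tree; typed ONLY as a hypothesis: no _holds, no instance, no default argument]
— every window-equivariant affine representation of `per_m` can be replaced by one of no larger size which is
window-equivariant AND local.
TRUE on paper: Krull–Schmidt for the Kronecker-quiver representation A; det A = per_m ≠ 0 forces square blocks; per_m irreducible and 𝔖_m×𝔖_m-invariant singles out one Γ-stable per-carrying block whose endomorphism pair algebra is local (Fitting) with residue field ℂ.
(That sentence is the critic's paper argument, recorded here as the road for g28; nothing of it is formalised below.) -/
def LocalShrinking : Prop :=
  ∀ (m s : ℕ) (A : Matrix (Fin s) (Fin s) (MvPolynomial (Fin m × Fin m) ℂ)),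
    IsEquivariantDetRepr (biPermSubst m) (perPoly (Fin m) ℂ) A →
      ∃ s' : ℕ, s' ≤ s ∧ ∃ A' : Matrix (Fin s') (Fin s') (MvPolynomial (Fin m × Fin m) ℂ),
        IsEquivariantDetRepr (biPermSubst m) (perPoly (Fin m) ℂ) A' ∧ IsLocalRepr A'

/-- ★ cell `A` from the elementary residual: `LocalShrinking → EqHardBiPerm`. -/
theorem eqHardBiPerm_of_localShrinking (h : LocalShrinking) : EqHardBiPerm := fun ⟨c, hc⟩ =>
  eqHardBiPermFin ⟨c, fun m => by
    obtain ⟨s, hs, A, hA⟩ := hc m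
    obtain ⟨s', hs', A', hA', hloc⟩ := h m s A hA
    refine ⟨s', hs'.trans hs, A', ?_⟩
    rcases Nat.eq_zero_or_pos s' with h0 | hpos
    · subst h0; exact isFinEquivariantDetRepr_of_size_zero hA'
    · haveI := finite_biPermSubst m
      exact isFinEquivariantDetRepr_of_isLocalRepr hpos hA' hloc⟩

end Window

end Summit.ValiantsHypothesis.ValiantsHypothesis.Theorems.EquivariantDialFiniteSupplement
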